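import Literature.MathematicalPhysics.QuantumFieldTheory.Balaban1983to89.B11Eq172LogBound

/-!
# `Balaban1983to89.B11SectGAnalyticV` — T. Bałaban, *The variational problem and background fields in renormalization group method for
lattice gauge theories*, Commun. Math. Phys. **102** (1985) 277–309 [Balaban1985Variational], Sect. G pp. 305–307 and **Proposition 9**
(p. 309), the «analytic function of V′» sentences: *«it is an analytic function of B = (1/i) log V′»* (p. 305), *«U₁ = exp iη𝓗(B)»* (p. 305),
*«This transformation is an analytic function of 𝓗, hence of B … It is an analytic function of V′, for V′ with values in a small neighborhood
of the identity in Gᶜ»* (p. 307), *«has an extension to an analytic function of Gᶜ-valued small configurations V′ … The function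
U_k(V′V₀)U_k(V₀)⁻¹ transformed to the Landau gauge is, by the definition, equal to exp iη𝓗(B), where B = 1/i log V′»* (Prop. 9) — the
COMPOSITION MECHANISM proved at scheme level: the bondwise logarithm `V′ ↦ B = (1/i) log V′` is analytic near `V′ = 1` (the tree's matrix
logarithm `MatrixLog.mlog`, (172)), so every analytic function of `B` on a ball containing `‖B‖ < 2C₁ε₁` is an analytic function of `V′` on
`|V′ − 1| < C₁ε₁`, jointly with any further analytic parameter `U`; `exp iη(·)` and any analytic «transformation back to the axial gauge» keep it so

statement-level skeleton of published theorems with citation tags; proofs where landed; nothing here is a claim about the Yang–Mills mass gap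

PDF held: `paper:balaban1985-cmp102-variational-background` (journal page = PDF page + 276); pp. 305–307 [PDF 29–31] and p. 309 [PDF 33] read
from the text layer `p0029.txt`–`p0033.txt` (this seat, 2026-08-21) and the renders `…-p029-x2.png`–`…-p033-x2.png` (gens 1, 9).

CITATION HEADER / WHAT IS REPRODUCED.  Mega-formalization `lit-balaban`, HOME `run/shared/lean/pub/lit-balaban/`, reader/typer/fold-owner seat
r08 gen 10 (unit `lit-balaban-r08`).  SKELETON rows **B11.Prop9** (decl of record `B11.Prop9Printed`; the clauses «determined by (174), (175) …
analytic function of B» = P2 p07 `B11Eq174Chart`, «analytic … also of U» = r08 g9 `B11Claim309UAnalytic`, Fréchet analyticity in B = p29 g9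
`B11MeanValue190Chart.analyticOnNhd_chartHB`), **B11.Eq181** (r08 g9 `B11Eq181AnalyticExtension`: the identity-principle step) and
**B11.Eq172** ((172), r08 g1 `B11Eq172LogBound.eq172`).  THE PRINT (verbatim).  p. 305 [29]: *"We will show that it is an analytic function
of V in the following sense: if V = V′V₀, V′ small, U₀ = U_k(V₀), and if we fix a gauge condition for U_k(V′V₀)U₀⁻¹, then it is an analytic
function of B = 1/i log V′ and it has an expansion as a power series in B. … V′ satisfies |V′ − 1| < C₁ε₁, hence V′ = e^{iB′}, |B′| < 2C₁ε₁ on 𝔅_k,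
(172) for ε₁ sufficiently small. … At first we fix the Landau gauge for the configuration U_k(V′V₀)U₀⁻¹ = U₁, and we have U₁ = exp iη𝓗(B)"*
(v1.1, r08 gen 46: the three p. 305 clips of this header and of `analyticOnNhd_comp_logCfg` now carry the printed prime, «B = 1/i log V′» —
the text layer drops it, the x2 render of p. 305 l. 9 has it; second reader r11 pass 6, note Q6-2; docstring-only, declarations unchanged);
p. 307 [31]: *"We make the gauge transformation inverse to the one applied previously, i.e. we transform the configuration in the Landau gauge
back to the axial gauge. This transformation is an analytic function of 𝓗, hence of B, and we obtain a gauge field configuration in the axial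
gauge, which we denote also by U_k(V′V₀). It is an analytic function of V′, for V′ with values in a small neighborhood of the identity in Gᶜ"*;
p. 309 [33], Proposition 9: *"The minimal configuration U_k(V) = U_k(V′V₀) in the axial gauge has an extension to an analytic function of
Gᶜ-valued small configurations V′ on 𝔅_k. … The function U_k(V′V₀)U_k(V₀)⁻¹ transformed to the Landau gauge is, by the definition, equal to
exp iη𝓗(B), where B = 1/i log V′. … It is an analytic function of B, and also of the external gauge field configuration U"*.

WHAT THIS FILE PROVES (theorems only; kernel-checked, 0 sorry, standard axioms).  Carrier: bond variables in a complete normed ℂ-algebra `𝔄`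
(the scheme's reading of Gᶜ ⊂ 𝔄, as in `B11Eq172LogBound`), configurations `V′, B : ι → 𝔄` on a finite bond set `ι` (sup norm), the
bondwise logarithm `B(V′) := (b ↦ (1/i)·log V′(b)) = (b ↦ (−i)·mlog (V′ b))` («B = 1/i log V′»).
* §1 `analyticAt_logCfg` / `analyticOnNhd_logCfg`: `V′ ↦ B(V′)` is analytic at every `V′` with `‖V′(b) − 1‖ < 1` for all `b`
  (`MatrixLog.analyticAt_mlog` componentwise, `analyticAt_pi_iff`); `eq172_cfg` / `norm_logCfg_lt`: (172) bondwise and in sup norm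
  (`‖V′(b) − 1‖ < C₁ε₁ ≤ ½` ⇒ `exp(iB(V′)(b)) = V′(b)`, `‖B(V′)‖ < 2C₁ε₁`).
* §2 «analytic function of B … hence of V′»: **`analyticOnNhd_comp_logCfg`** — ANY `𝓗` analytic on a neighbourhood-set `D ∋ B(V′)` gives
  `V′ ↦ 𝓗(B(V′))` analytic on `{V′ : ∀ b, ‖V′(b) − 1‖ < C₁ε₁}`; `analyticOnNhd_comp_logCfg_ball` (the case `D = {‖B‖ < r}`, `2C₁ε₁ ≤ r` — the
  shape of `B11MeanValue190Chart.analyticOnNhd_chartHB` / `B11Claim309UAnalytic.analyticOnNhd_chartH`); **`analyticOnNhd_comp_logCfg_pair`** —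
  jointly with an analytic parameter `U ∈ 𝒪` (the «also of the external gauge field configuration U» shape of
  `B11Claim309UAnalytic.analyticOnNhd_chartH_pair`).
* §3 «U₁ = exp iη𝓗(B)» and «This transformation is an analytic function of 𝓗, hence of B … an analytic function of V′»: `analyticAt_expCfg`
  (`G ↦ (x ↦ exp(c·G(x)))` is entire, `NormedSpace.exp_analytic` componentwise), **`analyticOnNhd_U1_of_V`** (`V′ ↦ exp iη𝓗(B(V′))` analytic on
  `|V′ − 1| < C₁ε₁`), **`analyticOnNhd_axial_of_V`** (followed by ANY analytic map `Φ` of the Landau-gauge configuration — the gauge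
  transformation back to the axial gauge as an abstract analytic function of `𝓗` — stays analytic in `V′`), `analyticOnNhd_axial_of_V_pair`
  (jointly with `U`).

READINGS / HONEST SCOPE.  (V1) «Gᶜ-valued small configurations V′» = `V′ : ι → 𝔄` with `‖V′(b) − 1‖ < C₁ε₁` bondwise, `C₁ε₁ ≤ ½` («for ε₁
sufficiently small», as in `B11Eq172LogBound`); the logarithm is the series logarithm `mlog` of [4] (21).  (V2) `𝓗` is ANY function analytic on
a set containing the balls `‖B‖ < 2C₁ε₁` — in the tree: the (174)/(179) charts `B11Eq174Chart.chartHB` / `B11Eq183Differentiation.chartH179`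
with their analyticity theorems (p07 g4, r08 g9, p29 g9); this file composes, it does not re-derive them.  (V3) «transformed to the Landau gauge
is, BY THE DEFINITION, equal to exp iη𝓗(B)»: taken as the definition of the Landau-gauge object `U₁(V′) := exp iη𝓗(B(V′))` (bondwise
exponential; no claim that it is the gauge transform of a lattice minimiser — that identification is rows B11.Thm1/B11.Eq174, NE9 (L-letters),
socket C19′ frozen).  (V4) «This transformation [back to the axial gauge] is an analytic function of 𝓗»: an abstract analytic `Φ` (in [6] it is a
finite product of exponentials along the axial-gauge paths; not constructed here).  (V5) «has an expansion as a power series in B» is the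
definition of analyticity (`AnalyticAt` = `∃ p, HasFPowerSeriesAt`); not restated.  NOT CLAIMED: the identity principle/extension (181) (row
B11.Eq181, `B11Eq181AnalyticExtension`), (173), (190), anything about [5]/[6]'s lattice objects, summit progress.  Imports `B11Eq172LogBound`
(→ `MatrixLog`); modifies nothing; no new named fact (net debt delta 0).
-/

noncomputable section

open scoped Topology
open NormedSpace Metric Set

namespace Literature.MathematicalPhysics.QuantumFieldTheory.Balaban1983to89.B11SectGAnalyticV

open MatrixLog (mlog analyticAt_mlog exp_mlog norm_mlog_le_two_mul)

variable {𝔄 : Type*} [NormedRing 𝔄] [NormedAlgebra ℂ 𝔄] [CompleteSpace 𝔄] {ι : Type*} [Fintype ι]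

/-! ## §1 `B = (1/i) log V′` bondwise: analyticity near `V′ = 1` and (172) -/

/-- **«B = 1/i log V′» is an analytic function of `V′`** at every configuration with `‖V′(b) − 1‖ < 1` for all bonds `b`: componentwise the
series logarithm `mlog` is analytic on `‖X − 1‖ < 1` (`MatrixLog.analyticAt_mlog`, [4] (21)), evaluation at `b` is continuous linear, and a
finite family of analytic components is analytic into the product (`analyticAt_pi_iff`). [cite: Balaban1985Variational, p.305, (172) p.305]
[cite: Balaban1985Averaging, (21) p.21] -/
theorem analyticAt_logCfg {V : ι → 𝔄} (hV : ∀ b, ‖V b - 1‖ < 1) :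
    AnalyticAt ℂ (fun W : ι → 𝔄 => fun b => (-Complex.I) • mlog (W b)) V := by
  refine analyticAt_pi_iff.2 fun b => ?_
  have h1 : AnalyticAt ℂ (fun W : ι → 𝔄 => W b) V := (ContinuousLinearMap.proj (R := ℂ) b).analyticAt V
  have h2 : AnalyticAt ℂ (fun W : ι → 𝔄 => mlog (W b)) V :=
    AnalyticAt.comp (g := (mlog : 𝔄 → 𝔄)) (f := fun W : ι → 𝔄 => W b) (x := V) (analyticAt_mlog (hV b)) h1
  exact h2.fun_const_smul (c := -Complex.I)

/-- `V′ ↦ B(V′)` is analytic on a neighbourhood of every point of `{V′ : ∀ b, ‖V′(b) − 1‖ < 1}`. [cite: Balaban1985Variational, p.305] -/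
theorem analyticOnNhd_logCfg :
    AnalyticOnNhd ℂ (fun W : ι → 𝔄 => fun b => (-Complex.I) • mlog (W b)) {V : ι → 𝔄 | ∀ b, ‖V b - 1‖ < 1} :=
  fun _ hV => analyticAt_logCfg hV

/-- in sup norm: `‖V′ − 1‖ < 1` ⇒ analytic at `V′`. [cite: Balaban1985Variational, p.305] -/
theorem analyticAt_logCfg_of_norm {V : ι → 𝔄} (hV : ‖V - 1‖ < 1) :
    AnalyticAt ℂ (fun W : ι → 𝔄 => fun b => (-Complex.I) • mlog (W b)) V :=
  analyticAt_logCfg fun b => (norm_le_pi_norm (V - 1) b).trans_lt hV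

omit [Fintype ι] in
/-- **(172), bondwise**: `‖V′(b) − 1‖ < C₁ε₁`, `C₁ε₁ ≤ ½` ⇒ `exp(i·B(V′)(b)) = V′(b)` and `‖B(V′)(b)‖ < 2C₁ε₁` (`B11Eq172LogBound.eq172`).
[cite: Balaban1985Variational, (172) p.305] -/
theorem eq172_cfg {V : ι → 𝔄} {C₁ε₁ : ℝ} (hV : ∀ b, ‖V b - 1‖ < C₁ε₁) (hs : C₁ε₁ ≤ 1 / 2) (b : ι) :
    exp (Complex.I • ((-Complex.I) • mlog (V b))) = V b ∧ ‖(-Complex.I) • mlog (V b)‖ < 2 * C₁ε₁ :=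
  B11Eq172LogBound.eq172 (hV b) hs

/-- **(172) in sup norm**: `‖B(V′)‖ < 2C₁ε₁` on `𝔅_k` (finite bond set; `0 < C₁ε₁` for the empty-index case). [cite: Balaban1985Variational, (172) p.305] -/
theorem norm_logCfg_lt {V : ι → 𝔄} {C₁ε₁ : ℝ} (hV : ∀ b, ‖V b - 1‖ < C₁ε₁) (hs : C₁ε₁ ≤ 1 / 2) (hpos : 0 < C₁ε₁) :
    ‖(fun b => (-Complex.I) • mlog (V b))‖ < 2 * C₁ε₁ :=
  (pi_norm_lt_iff (by positivity)).2 fun b => (eq172_cfg hV hs b).2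

/-! ## §2 «analytic function of B … hence of V′»: composition with any analytic function of `B` -/

section Comp

variable {𝒴 : Type*} [NormedAddCommGroup 𝒴] [NormedSpace ℂ 𝒴]

/-- **Every analytic function of `B` is an analytic function of `V′`**: if `𝓗` is analytic on a neighbourhood of each point of a set `D` and
`B(V′) ∈ D` for every `V′` of a set `S` of configurations with `‖V′(b) − 1‖ < 1` bondwise, then `V′ ↦ 𝓗(B(V′))` is analytic on a neighbourhood of
each point of `S` (*«it is an analytic function of B = 1/i log V′»*, *«… hence of B … an analytic function of V′»*).
[cite: Balaban1985Variational, p.305, p.307, Prop. 9 p.309] -/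
theorem analyticOnNhd_comp_logCfg {𝓗 : (ι → 𝔄) → 𝒴} {D S : Set (ι → 𝔄)} (h𝓗 : AnalyticOnNhd ℂ 𝓗 D)
    (hS : ∀ V ∈ S, ∀ b, ‖V b - 1‖ < 1) (hSD : ∀ V ∈ S, (fun b => (-Complex.I) • mlog (V b)) ∈ D) :
    AnalyticOnNhd ℂ (fun V : ι → 𝔄 => 𝓗 (fun b => (-Complex.I) • mlog (V b))) S :=
  fun V hV => (h𝓗 _ (hSD V hV)).comp (analyticAt_logCfg (hS V hV))

/-- The case of a chart analytic on the ball `‖B‖ < r` with `2C₁ε₁ ≤ r` (the domain shape of `B11Eq174Chart`/`B11Claim309UAnalytic`/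
`B11MeanValue190Chart`: `{B : ‖H₁B‖ < a}` contains such a ball when `‖H₁‖·2C₁ε₁ < a`): `V′ ↦ 𝓗(B(V′))` is analytic on the small
configurations `{V′ : ∀ b, ‖V′(b) − 1‖ < C₁ε₁}`, `0 < C₁ε₁ ≤ ½` — by (172). [cite: Balaban1985Variational, (172) p.305, Prop. 9 p.309] -/
theorem analyticOnNhd_comp_logCfg_ball {𝓗 : (ι → 𝔄) → 𝒴} {r C₁ε₁ : ℝ} (h𝓗 : AnalyticOnNhd ℂ 𝓗 (ball (0 : ι → 𝔄) r))
    (hs : C₁ε₁ ≤ 1 / 2) (hpos : 0 < C₁ε₁) (hr : 2 * C₁ε₁ ≤ r) :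
    AnalyticOnNhd ℂ (fun V : ι → 𝔄 => 𝓗 (fun b => (-Complex.I) • mlog (V b))) {V : ι → 𝔄 | ∀ b, ‖V b - 1‖ < C₁ε₁} :=
  analyticOnNhd_comp_logCfg h𝓗 (fun V hV b => (hV b).trans_le (by linarith))
    fun V hV => mem_ball_zero_iff.2 ((norm_logCfg_lt hV hs hpos).trans_le hr)

variable {𝒰 : Type*} [NormedAddCommGroup 𝒰] [NormedSpace ℂ 𝒰]

/-- **Jointly with an analytic parameter** (*«It is an analytic function of B, and also of the external gauge field configuration U»*): if
`(U, B) ↦ 𝓗(U, B)` is analytic on a neighbourhood of each point of `𝒪 ×ˢ D` (the output shape of `B11Claim309UAnalytic.analyticOnNhd_chartH_pair`),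
then `(U, V′) ↦ 𝓗(U, B(V′))` is analytic on a neighbourhood of each point of `𝒪 ×ˢ S`. [cite: Balaban1985Variational, Prop. 9 p.309, p.307] -/
theorem analyticOnNhd_comp_logCfg_pair {𝓗 : 𝒰 × (ι → 𝔄) → 𝒴} {𝒪 : Set 𝒰} {D S : Set (ι → 𝔄)}
    (h𝓗 : AnalyticOnNhd ℂ 𝓗 (𝒪 ×ˢ D)) (hS : ∀ V ∈ S, ∀ b, ‖V b - 1‖ < 1)
    (hSD : ∀ V ∈ S, (fun b => (-Complex.I) • mlog (V b)) ∈ D) :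
    AnalyticOnNhd ℂ (fun p : 𝒰 × (ι → 𝔄) => 𝓗 (p.1, fun b => (-Complex.I) • mlog (p.2 b))) (𝒪 ×ˢ S) := by
  intro p hp
  rw [mem_prod] at hp
  have hlog : AnalyticAt ℂ (fun p : 𝒰 × (ι → 𝔄) => fun b => (-Complex.I) • mlog (p.2 b)) p :=
    (analyticAt_logCfg (hS p.2 hp.2)).comp analyticAt_snd
  exact (h𝓗 _ (mk_mem_prod hp.1 (hSD p.2 hp.2))).comp₂ analyticAt_fst hlog

end Comp

/-! ## §3 «U₁ = exp iη𝓗(B)» and the transformation back to the axial gauge -/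

section Exp

variable {κ : Type*} [Fintype κ]

/-- the bondwise exponential `G ↦ (x ↦ exp(c·G(x)))` is an entire function of the configuration `G : κ → 𝔄` (`NormedSpace.exp_analytic`
componentwise). [cite: Balaban1985Variational, p.305] -/
theorem analyticAt_expCfg (c : ℂ) (G : κ → 𝔄) :
    AnalyticAt ℂ (fun F : κ → 𝔄 => fun x => exp (c • F x)) G := by
  refine analyticAt_pi_iff.2 fun x => ?_
  have h1 : AnalyticAt ℂ (fun F : κ → 𝔄 => c • F x) G :=
    ((ContinuousLinearMap.proj (R := ℂ) x).analyticAt G).fun_const_smul (c := c)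
  exact AnalyticAt.comp (g := (exp : 𝔄 → 𝔄)) (f := fun F : κ → 𝔄 => c • F x) (x := G)
    (NormedSpace.exp_analytic (𝕂 := ℂ) (c • G x)) h1

variable {𝒴 : Type*} [NormedAddCommGroup 𝒴] [NormedSpace ℂ 𝒴]

/-- **«U₁ = exp iη𝓗(B)» is an analytic function of `V′`** on the small configurations: for `𝓗 : (ι → 𝔄) → (κ → 𝔄)` analytic on a
neighbourhood-set `D` containing the `B(V′)`, `V′ ∈ S`, the Landau-gauge object `V′ ↦ (x ↦ exp(iη·𝓗(B(V′))(x)))` is analytic on a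
neighbourhood of each point of `S` (reading (V3): «by the definition»). [cite: Balaban1985Variational, p.305, Prop. 9 p.309] -/
theorem analyticOnNhd_U1_of_V {𝓗 : (ι → 𝔄) → (κ → 𝔄)} {D S : Set (ι → 𝔄)} (η : ℝ) (h𝓗 : AnalyticOnNhd ℂ 𝓗 D)
    (hS : ∀ V ∈ S, ∀ b, ‖V b - 1‖ < 1) (hSD : ∀ V ∈ S, (fun b => (-Complex.I) • mlog (V b)) ∈ D) :
    AnalyticOnNhd ℂ
      (fun V : ι → 𝔄 => fun x => exp ((Complex.I * (η : ℂ)) • 𝓗 (fun b => (-Complex.I) • mlog (V b)) x)) S :=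
  fun V hV => (analyticAt_expCfg (Complex.I * (η : ℂ)) _).comp (analyticOnNhd_comp_logCfg h𝓗 hS hSD V hV)

variable {𝒲 : Type*} [NormedAddCommGroup 𝒲] [NormedSpace ℂ 𝒲] {𝒰 : Type*} [NormedAddCommGroup 𝒰] [NormedSpace ℂ 𝒰]

/-- **«This transformation is an analytic function of 𝓗, hence of B … It is an analytic function of V′»**: any map `Φ` of the Landau-gauge
configuration that is analytic on a neighbourhood-set `E` containing the values `U₁(V′)`, `V′ ∈ S` (reading (V4): the gauge transformation back
to the axial gauge as an abstract analytic function), composed with `V′ ↦ U₁(V′) = exp iη𝓗(B(V′))`, is analytic on a neighbourhood of each point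
of `S` — the axial-gauge `U_k(V′V₀)` «is an analytic function of V′». [cite: Balaban1985Variational, p.307, Prop. 9 p.309] -/
theorem analyticOnNhd_axial_of_V {𝓗 : (ι → 𝔄) → (κ → 𝔄)} {D S : Set (ι → 𝔄)} {Φ : (κ → 𝔄) → 𝒲} {E : Set (κ → 𝔄)}
    (η : ℝ) (hΦ : AnalyticOnNhd ℂ Φ E) (h𝓗 : AnalyticOnNhd ℂ 𝓗 D) (hS : ∀ V ∈ S, ∀ b, ‖V b - 1‖ < 1)
    (hSD : ∀ V ∈ S, (fun b => (-Complex.I) • mlog (V b)) ∈ D)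
    (hE : ∀ V ∈ S, (fun x => exp ((Complex.I * (η : ℂ)) • 𝓗 (fun b => (-Complex.I) • mlog (V b)) x)) ∈ E) :
    AnalyticOnNhd ℂ
      (fun V : ι → 𝔄 => Φ (fun x => exp ((Complex.I * (η : ℂ)) • 𝓗 (fun b => (-Complex.I) • mlog (V b)) x))) S :=
  fun V hV => (hΦ _ (hE V hV)).comp (analyticOnNhd_U1_of_V η h𝓗 hS hSD V hV)

/-- The same with an analytic parameter `U ∈ 𝒪` carried along (joint analyticity in `(U, V′)` of the axial-gauge object).
[cite: Balaban1985Variational, p.307, Prop. 9 p.309] -/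
theorem analyticOnNhd_axial_of_V_pair {𝓗 : 𝒰 × (ι → 𝔄) → (κ → 𝔄)} {𝒪 : Set 𝒰} {D S : Set (ι → 𝔄)}
    {Φ : 𝒰 × (κ → 𝔄) → 𝒲} {E : Set (κ → 𝔄)} (η : ℝ) (hΦ : AnalyticOnNhd ℂ Φ (𝒪 ×ˢ E))
    (h𝓗 : AnalyticOnNhd ℂ 𝓗 (𝒪 ×ˢ D)) (hS : ∀ V ∈ S, ∀ b, ‖V b - 1‖ < 1)
    (hSD : ∀ V ∈ S, (fun b => (-Complex.I) • mlog (V b)) ∈ D)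
    (hE : ∀ p ∈ 𝒪 ×ˢ S, (fun x => exp ((Complex.I * (η : ℂ)) • 𝓗 (p.1, fun b => (-Complex.I) • mlog (p.2 b)) x)) ∈ E) :
    AnalyticOnNhd ℂ
      (fun p : 𝒰 × (ι → 𝔄) =>
        Φ (p.1, fun x => exp ((Complex.I * (η : ℂ)) • 𝓗 (p.1, fun b => (-Complex.I) • mlog (p.2 b)) x))) (𝒪 ×ˢ S) := by
  intro p hp
  have hH := analyticOnNhd_comp_logCfg_pair h𝓗 hS hSD p hp
  have hU1 : AnalyticAt ℂ
      (fun q : 𝒰 × (ι → 𝔄) => fun x => exp ((Complex.I * (η : ℂ)) • 𝓗 (q.1, fun b => (-Complex.I) • mlog (q.2 b)) x)) p :=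
    (analyticAt_expCfg (Complex.I * (η : ℂ)) _).comp hH
  have hp' : p ∈ 𝒪 ×ˢ S := hp
  rw [mem_prod] at hp'
  exact (hΦ _ (mk_mem_prod hp'.1 (hE p hp))).comp₂ analyticAt_fst hU1

end Exp

end Literature.MathematicalPhysics.QuantumFieldTheory.Balaban1983to89.B11SectGAnalyticV

end
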